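import Summits.NavierStokesRegularity.OSWSelfSimilar.SheetRCertifiedProfileOfRecordSeven
import Summits.NavierStokesRegularity.OSWSelfSimilar.SheetRTranslationModeOfRecord
import HarnessLib

/-!
# SHEET-ℝ frame: THE NEWTON–KANTOROVICH ROW FOR THE OBJECTS OF RECORD — exactly one certified `δ`, MODEL blow-up of `Ω* = Ω̄ + prim (der δ)`, and the
# even translation-mode word, each modulo ONLY the four printed NK inequalities (#5 capacitance inverse, #6 `K_NwB`, #7 `ε_NB`, #8b `η_B2`)

HONEST FRAMING (cell ns-blowup GROUP B / zone Z3, case Z3-SR-CERT (+ the even items PO-2/PO-3 of Z3-SR-SPEC); 1-D MODEL certificate (viscous gCLM/OSW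
sheet on the line at `(a, c_l, ε) = (1/5, 1/2, 1)`); computer-assisted frame; not Euler/NS; «violates: none — MODEL»).  cert-2's generic implementation-2
theorems `SheetRCertificateAssemblyB.existsUnique_weakSolutionB` / `modelBlowup_of_weakSolutionB` and cert-1's `SheetRTranslationModeOfRecord.translationMode_word_ofRecord`
carry the Newton–Kantorovich hypotheses #1 `hc`, #2 `hΩ₁`, #3 `hC1`, #4 `S₀, hS₀`, #5 `f ℓ Nmat hN₁ hN₂`, #6 `hKNwB`, #7 `hepsNB`, #8a `hG`, #8b `hηB` (+ #9 `hX₀`).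
For the OBJECTS OF RECORD rows #1, #2, #9 are selfsim g13's kernel facts, #3 is `SheetRPointwiseDatumOfRecord.pointwiseDatum_centreOfRecord`, #4 is the
defined operator `SheetRCertifiedProfileOfRecordSeven.baseSolutionOperator`, #8a is cert-1's `integrable_weight_residual_sq_centreOfRecord`.  Hence, modulo
EXACTLY the four interval sentences #5 #6 #7 #8b (implementation 2's printed Newton–Kantorovich arithmetic about defined objects):

* **`existsUnique_weakSolution_ofRecord`** — exactly one `δ` with `‖δ‖_E ≤ rEBR2` solving the linearised weak profile equation at `centreOfRecord`;
* **`modelBlowup_ofRecord`** — for any such `δ`, `Ω* = centreOfRecord + prim (der δ)` is `C²` and its exact self-similar function is a classical solution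
  of the 1-D MODEL `ω_t + (1/5)uω_x = u_xω + ω_xx` on `ℝ × [0, T)` whose sup norm blows up at `T`, for every `T > 0`;
* **`translationMode_word_ofRecord₄`** — cert-1's even word (PO-2 ∧ PO-3: `σ = ½` is an exact eigenvalue of `−DG⁺(Ω*)` with eigenvector `Ω*′ ∈ E⁺₀`,
  `Ω*′ ≢ 0`) with the same four hypotheses.
No definition, no named fact.  WHAT THIS IS NOT: not NS — «a certified MODEL profile that blows up in its MODEL is not an NS blow-up»; the four remaining
inequalities are NOT proved here.
-/

noncomputable section

namespace Summit.NavierStokesRegularity.OSWSelfSimilar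
namespace SheetRNewtonKantorovichOfRecord

open _root_.MeasureTheory _root_.Set _root_.Filter _root_.Real _root_.Metric Literature.Analysis.Fourier Literature.Analysis.FluidPDE
  Literature.Analysis.OperatorTheory SheetRWeakProfilePV SheetRWeakToStrong
  SheetREnergyClass SheetRWeightedMeasure SheetREnergySpace SheetRLinearisedTests SheetRTestSpace SheetRLinearisedFormBounds
  SheetRSolutionOperator SheetRAssemblyOperators SheetRCertificateAssembly SheetRCertificateCoercivity SheetRCertificateAssemblyB
  SheetRSpectrumCertifiedProfile SheetRTranslationModeAssembly SheetRFrameCentre SheetRCentreOfRecord SheetRCentreOfRecordValue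
  SheetRFrameCentreResidual SheetRCertifiedProfileOfRecord SheetRPointwiseDatumOfRecord SheetRCertifiedProfileOfRecordSeven
  SheetRTranslationModeOfRecord CertificateViscousSheetR Matrix Finset
open scoped Topology ENNReal ContDiff BigOperators

variable {n : ℕ} (f : Fin n → W 8) (ℓ : Fin n → Esp 8 eight_pos →L[ℝ] ℝ) (Nmat : Matrix (Fin n) (Fin n) ℝ)
  (hN₁ : (1 - capMatrix (fun i => baseSolutionOperator (f i)) ℓ) * Nmat = 1)
  (hN₂ : Nmat * (1 - capMatrix (fun i => baseSolutionOperator (f i)) ℓ) = 1)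
  (hKNwB : ∀ g : W 8, ‖capInverse (fun i => baseSolutionOperator (f i)) ℓ Nmat (baseSolutionOperator g)‖ ≤ (KNwB : ℝ) * ‖g‖)
  (hepsNB : ∀ u : Esp 8 eight_pos, ‖PopC eight_pos 4 (1 / 5) isCentre_centreOfRecord u - ∑ i, ℓ i u • f i‖ ≤ (epsNBR : ℝ) * ‖u‖)
  (hηB : Real.sqrt (∫ y, ((8:ℝ) ^ 2 + y ^ 2) * (centreOfRecord y + 1 / 2 * y * centreOfRecordDeriv y
    + 1 / 5 * (∫ s in (0 : ℝ)..y, hilbertTransform centreOfRecord s) * centreOfRecordDeriv y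
    - hilbertTransform centreOfRecord y * centreOfRecord y - deriv centreOfRecordDeriv y) ^ 2) ≤ (etaB2 : ℝ))

include hN₁ hN₂ hKNwB hepsNB hηB in
/-- **EXACTLY ONE CERTIFIED `δ` FOR THE CENTRE OF RECORD (MODEL; rows #5 #6 #7 #8b as the only hypotheses).**  There is exactly one `δ` with
`‖δ‖_E ≤ rEBR2` whose profile solves the linearised weak equation `B_λ(δ; v) = ∫ w·(Pδ − G(Ω̄) − Qδδ)·v` at `Ω̄ = centreOfRecord` on compactly supported
tests — `existsUnique_weakSolutionB` with rows #1 #2 #3 #4 #8a supplied by kernel facts.  MODEL statement; not NS. [folklore] -/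
theorem existsUnique_weakSolution_ofRecord :
    ∃! δ : Esp 8 eight_pos, δ ∈ closedBall (0 : Esp 8 eight_pos) (rEBR2 : ℝ) ∧
      ∀ v v₁ : ℝ → ℝ, IsCompactTest v v₁ →
        linForm 8 (drift (1 / 5) centreOfRecord) (potential 8 4 centreOfRecord) (prim (der δ)) (der δ) v v₁ =
          ∫ y, ((8:ℝ) ^ 2 + y ^ 2) * ((PopFun 8 4 (1 / 5) centreOfRecord centreOfRecordDeriv δ y
            - (centreOfRecord y + 1 / 2 * y * centreOfRecordDeriv y
              + 1 / 5 * (∫ s in (0 : ℝ)..y, hilbertTransform centreOfRecord s) * centreOfRecordDeriv y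
              - hilbertTransform centreOfRecord y * centreOfRecord y - deriv centreOfRecordDeriv y)
            - QFun 8 (1 / 5) δ δ y) * v y) :=
  existsUnique_weakSolutionB isCentre_centreOfRecord (contDiff_centreOfRecordDeriv (k := 1)) pointwiseDatum_centreOfRecord
    baseSolutionOperator baseSolutionOperator_eq f ℓ Nmat hN₁ hN₂ hKNwB hepsNB integrable_weight_residual_sq_centreOfRecord hηB

include hN₁ hN₂ hKNwB hepsNB in
/-- **MODEL BLOW-UP OF THE CERTIFIED PROFILE OF RECORD (rows #5 #6 #7 as the only hypotheses).**  Every `δ` in the `rEBR2`-ball solving the linearised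
weak equation at `centreOfRecord` (there is exactly one, `existsUnique_weakSolution_ofRecord`) gives a `C²` profile `Ω* = centreOfRecord + prim (der δ)`
whose exact self-similar function `(T − t)⁻¹Ω*(x/√(T − t))` is a classical solution of the 1-D MODEL `ω_t + (1/5)uω_x = u_xω + ω_xx` on `ℝ × [0, T)`
with sup norm blowing up at `T`, for every `T > 0` — `modelBlowup_of_weakSolutionB` with rows #1 #2 #3 #4 #8a #9 supplied by kernel facts (`X₀ = 8`).
1-D MODEL; NOT Navier–Stokes. [folklore] -/
theorem modelBlowup_ofRecord {δ : Esp 8 eight_pos} (hball : δ ∈ closedBall (0 : Esp 8 eight_pos) (rEBR2 : ℝ))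
    (hweak : ∀ v v₁ : ℝ → ℝ, IsCompactTest v v₁ →
      linForm 8 (drift (1 / 5) centreOfRecord) (potential 8 4 centreOfRecord) (prim (der δ)) (der δ) v v₁ =
        ∫ y, ((8:ℝ) ^ 2 + y ^ 2) * ((PopFun 8 4 (1 / 5) centreOfRecord centreOfRecordDeriv δ y
          - (centreOfRecord y + 1 / 2 * y * centreOfRecordDeriv y
            + 1 / 5 * (∫ s in (0 : ℝ)..y, hilbertTransform centreOfRecord s) * centreOfRecordDeriv y
            - hilbertTransform centreOfRecord y * centreOfRecord y - deriv centreOfRecordDeriv y)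
          - QFun 8 (1 / 5) δ δ y) * v y))
    {T : ℝ} (hT : 0 < T) :
    ContDiff ℝ 2 (fun y => centreOfRecord y + prim (der δ) y) ∧
      IsGCLMLineSolution (1 / 5) 1 (gclmSelfSimilar (-1) (1 / 2) T (fun y => centreOfRecord y + prim (der δ) y)) T ∧
      SupNormBlowupBefore (gclmSelfSimilar (-1) (1 / 2) T (fun y => centreOfRecord y + prim (der δ) y)) T :=
  modelBlowup_of_weakSolutionB isCentre_centreOfRecord (contDiff_centreOfRecordDeriv (k := 1)) pointwiseDatum_centreOfRecord
    baseSolutionOperator baseSolutionOperator_eq f ℓ Nmat hN₁ hN₂ hKNwB hepsNB integrable_weight_residual_sq_centreOfRecord hball hweak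
    rEBR2_lt_abs_centreOfRecord_eight hT

include hN₁ hN₂ hKNwB hepsNB hηB in
/-- **THE EVEN EXISTENCE WORD FOR THE CENTRE OF RECORD WITH FOUR HYPOTHESES (PO-2 ∧ PO-3).**  cert-1's `translationMode_word_ofRecord` with rows #3
(`pointwiseDatum_centreOfRecord`), #4 (`baseSolutionOperator`) and #8a (`integrable_weight_residual_sq_centreOfRecord`) discharged: under rows #5 #6 #7 #8b
alone there is exactly one `δ` in the `rEBR2`-ball solving the linearised weak equation at `centreOfRecord`, and for `Ω* = centreOfRecord + prim (der δ)`: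
`Ω*` is a centre in `C³`, `DG⁺(Ω*)[Ω*′] = −½Ω*′` pointwise, `Ω*′` is even with `∫(64+ξ²)Ω*′² < ∞`, `∫(64+ξ²)Ω*″² < ∞`, `∫Ω*′ = 0`, and `Ω*′ ≢ 0`.
Conclusion verbatim.  MODEL statement; not NS. [folklore] -/
theorem translationMode_word_ofRecord₄ :
    ∃ δ : Esp 8 eight_pos, δ ∈ closedBall (0 : Esp 8 eight_pos) (rEBR2 : ℝ) ∧
      (∀ v v₁ : ℝ → ℝ, IsCompactTest v v₁ →
        linForm 8 (drift (1 / 5) centreOfRecord) (potential 8 4 centreOfRecord) (prim (der δ)) (der δ) v v₁ =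
          ∫ y, ((8:ℝ) ^ 2 + y ^ 2) * ((PopFun 8 4 (1 / 5) centreOfRecord centreOfRecordDeriv δ y
            - (centreOfRecord y + 1 / 2 * y * centreOfRecordDeriv y
              + 1 / 5 * (∫ s in (0 : ℝ)..y, hilbertTransform centreOfRecord s) * centreOfRecordDeriv y
              - hilbertTransform centreOfRecord y * centreOfRecord y - deriv centreOfRecordDeriv y)
            - QFun 8 (1 / 5) δ δ y) * v y)) ∧
      (∀ δ' ∈ closedBall (0 : Esp 8 eight_pos) (rEBR2 : ℝ),
        (∀ v v₁ : ℝ → ℝ, IsCompactTest v v₁ →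
          linForm 8 (drift (1 / 5) centreOfRecord) (potential 8 4 centreOfRecord) (prim (der δ')) (der δ') v v₁ =
            ∫ y, ((8:ℝ) ^ 2 + y ^ 2) * ((PopFun 8 4 (1 / 5) centreOfRecord centreOfRecordDeriv δ' y
              - (centreOfRecord y + 1 / 2 * y * centreOfRecordDeriv y
                + 1 / 5 * (∫ s in (0 : ℝ)..y, hilbertTransform centreOfRecord s) * centreOfRecordDeriv y
                - hilbertTransform centreOfRecord y * centreOfRecord y - deriv centreOfRecordDeriv y)
              - QFun 8 (1 / 5) δ' δ' y) * v y)) → δ' = δ) ∧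
      ∃ (Ωs₁ : ℝ → ℝ) (Hs : ℝ), IsCentre 8 (fun y => centreOfRecord y + prim (der δ) y) Ωs₁ Hs ∧
        ContDiff ℝ 3 (fun y => centreOfRecord y + prim (der δ) y) ∧
        (∀ X, deriv (fun y => centreOfRecord y + prim (der δ) y) X
            + 1 / 2 * X * deriv (deriv (fun y => centreOfRecord y + prim (der δ) y)) X
            + 1 / 5 * (hilbertTransform (fun y => centreOfRecord y + prim (der δ) y) X
                * deriv (fun y => centreOfRecord y + prim (der δ) y) X
              + (∫ s in (0 : ℝ)..X, hilbertTransform (fun y => centreOfRecord y + prim (der δ) y) s)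
                * deriv (deriv (fun y => centreOfRecord y + prim (der δ) y)) X)
            - hilbertTransform (deriv (fun y => centreOfRecord y + prim (der δ) y)) X * (centreOfRecord X + prim (der δ) X)
            - hilbertTransform (fun y => centreOfRecord y + prim (der δ) y) X * deriv (fun y => centreOfRecord y + prim (der δ) y) X
            - 1 * iteratedDeriv 2 (deriv (fun y => centreOfRecord y + prim (der δ) y)) X
          = -(1 / 2) * deriv (fun y => centreOfRecord y + prim (der δ) y) X) ∧
        (∀ y, deriv (fun y => centreOfRecord y + prim (der δ) y) (-y) = deriv (fun y => centreOfRecord y + prim (der δ) y) y) ∧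
        (Integrable fun y => ((8:ℝ) ^ 2 + y ^ 2) * deriv (fun y => centreOfRecord y + prim (der δ) y) y ^ 2) ∧
        (Integrable fun y => ((8:ℝ) ^ 2 + y ^ 2) * deriv (deriv (fun y => centreOfRecord y + prim (der δ) y)) y ^ 2) ∧
        (∫ y, deriv (fun y => centreOfRecord y + prim (der δ) y) y = 0) ∧
        ∃ X, deriv (fun y => centreOfRecord y + prim (der δ) y) X ≠ 0 :=
  translationMode_word_ofRecord pointwiseDatum_centreOfRecord baseSolutionOperator baseSolutionOperator_eq f ℓ Nmat hN₁ hN₂ hKNwB hepsNB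
    integrable_weight_residual_sq_centreOfRecord hηB

end SheetRNewtonKantorovichOfRecord
end Summit.NavierStokesRegularity.OSWSelfSimilar

end
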